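import Summits.CriticalPhenomena.CardyFormulaZ2.Theorems.CardyBondTriangularBondTriangularBoxCrossingMoves
import HarnessLib

/-!
# Route CardyBondTriangular — item `BondTriangularBoxCrossing`: the composite moves

The two composite star–triangle moves of Grimmett–Manolescu's sweep (PTRF 159 (2014), §7) on the
labels of `𝕋`, assembled from `connEquiv_triToStar`, `connEquiv_afterMove`, the pendant-edge
moves and the relabelling `S ↔ A` of `CardyBondTriangularBondTriangularBoxCrossingMoves`:

* `connEquiv_doubleStep` — triangle → star at an up-triangle `{x, y, A}` with the spare label `S`
  as centre, star → triangle at the former apex `A`, relabelling; net effect on the weights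
  `{x,y} : t ↦ 0`, `{x,A}, {y,A} : t ↦ 1 − t`, `{A,u}, {A,w} : 1 − t ↦ t`, `{u,w} : 0 ↦ t`;
* `connEquiv_halfStep` — the same at the top row (`A` has no upper edges): triangle → star,
  removal of the pendant edge at `A`, relabelling; net effect `{x,y} : t ↦ 0`,
  `{x,A}, {y,A} : t ↦ 1 − t`.
-/

noncomputable section

namespace Summit.CriticalPhenomena.CardyFormulaZ2.Theorems.TriSweep

open MeasureTheory Literature.Probability.Percolation Literature.Probability.LatticeModels
open Literature.Probability.Percolation.StarTriangle

variable {V : Type*}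

section Moves

variable [DecidableEq V] [Countable V] {W : Set V}

set_option linter.unusedSimpArgs false in
set_option maxHeartbeats 800000 in
/-- **The double step** (GM14 §7 on `𝕋`, one elementary push of a horizontal edge by one level):
triangle → star at the up-triangle `{x, y, A}` with the spare label `S` as centre, star → triangle
at the former apex `A` (whose only other edges are `{A, u}`, `{A, w}`, of weight `1 − t`), and the
relabelling `S ↔ A`. If `3t − t³ = 1`, `t < 1`, the weights `p'` obtained from `p` by
`{x,y} ↦ 0`, `{x,A}, {y,A} ↦ 1 − t`, `{A,u}, {A,w}, {u,w} ↦ t` (all other pairs unchanged, `S`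
isolated before and after) are connectively equivalent to `p` for every protected set avoiding
`A` and `S`. -/
theorem connEquiv_doubleStep {p p' : Sym2 V → unitInterval} {x y A u w S : V}
    (hxy : x ≠ y) (hxA : x ≠ A) (hxu : x ≠ u) (hxw : x ≠ w) (hxS : x ≠ S)
    (hyA : y ≠ A) (hyu : y ≠ u) (hyw : y ≠ w) (hyS : y ≠ S)
    (hAu : A ≠ u) (hAw : A ≠ w) (hAS : A ≠ S) (huw : u ≠ w) (huS : u ≠ S) (hwS : w ≠ S)
    (hAW : A ∉ W) (hSW : S ∉ W) {t : unitInterval}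
    (ht3 : 3 * (t : ℝ) - (t : ℝ) ^ 3 = 1) (ht1 : (t : ℝ) < 1)
    (p_xy : p s(x, y) = t) (p_xA : p s(x, A) = t) (p_yA : p s(y, A) = t)
    (p_Au : p s(A, u) = unitInterval.symm t) (p_Aw : p s(A, w) = unitInterval.symm t)
    (p_uw : p s(u, w) = 0)
    (p_A0 : ∀ z, z ≠ x → z ≠ y → z ≠ u → z ≠ w → p s(A, z) = 0)
    (p_S0 : ∀ z, p s(S, z) = 0)
    (p'_xy : p' s(x, y) = 0) (p'_xA : p' s(x, A) = unitInterval.symm t)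
    (p'_yA : p' s(y, A) = unitInterval.symm t)
    (p'_Au : p' s(A, u) = t) (p'_Aw : p' s(A, w) = t) (p'_uw : p' s(u, w) = t)
    (p'_A0 : ∀ z, z ≠ x → z ≠ y → z ≠ u → z ≠ w → p' s(A, z) = 0)
    (p'_S0 : ∀ z, p' s(S, z) = 0)
    (p'_rest : ∀ a b, s(a, b) ≠ s(x, y) → s(a, b) ≠ s(u, w) → a ≠ A → b ≠ A → a ≠ S → b ≠ S →
      p' s(a, b) = p s(a, b)) :
    ConnEquiv W (∅ : Set (Sym2 V)) p p' := by
  have p_S0' : ∀ z, p s(z, S) = 0 := fun z => by rw [Sym2.eq_swap]; exact p_S0 z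
  have p_AA : p s(A, A) = 0 := p_A0 A hxA.symm hyA.symm hAu hAw
  have p'_AA : p' s(A, A) = 0 := p'_A0 A hxA.symm hyA.symm hAu hAw
  -- Step 1: triangle → star at `{x, y, A}` with centre `S`
  set p₁ : Sym2 V → unitInterval := afterMove p ![x, y, A] S with hp₁
  have hv := injective_vec3 hxy hxA hyA
  have hvO : ∀ k, (![x, y, A] : Fin 3 → V) k ≠ S := by
    intro k; fin_cases k <;> simpa
  obtain ⟨t0, t1, t2⟩ := triEdge_vec3 x y A
  have hpt : ∀ k, p (triEdge ![x, y, A] k) = t := by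
    intro k; fin_cases k
    · exact t0 ▸ p_yA
    · exact t1 ▸ p_xA
    · exact t2 ▸ p_xy
  have hS0 : ∀ e, S ∈ e → p e = 0 := by
    intro e he
    induction e using Sym2.ind with
    | h a b =>
      rcases Sym2.mem_iff.1 he with rfl | rfl
      · exact p_S0 b
      · exact p_S0' a
  have step1 : ConnEquiv W (∅ : Set (Sym2 V)) p p₁ := by
    refine connEquiv_afterMove hv hvO hS0 ?_ ?_ hSW (fun e he => absurd he (Set.notMem_empty e))
    · have : (fun k => ((p (triEdge ![x, y, A] k) : unitInterval) : ℝ)) = fun _ => (t : ℝ) := by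
        funext k; rw [hpt k]
      rw [this, kappa_const]; linarith
    · intro k; rw [hpt k]; exact ht1
  -- Step 2: star → triangle at `A` (corners `u, w, S`), as the reverse of a triangle → star move
  set p₂ : Sym2 V → unitInterval := fun e =>
    if A ∈ e then 0 else if e = s(u, w) ∨ e = s(u, S) ∨ e = s(w, S) then t else p₁ e with hp₂
  have hv' := injective_vec3 huw huS hwS
  have hvO' : ∀ k, (![u, w, S] : Fin 3 → V) k ≠ A := by
    intro k; fin_cases k
    · simpa using hAu.symm
    · simpa using hAw.symm
    · simpa using hAS.symm
  obtain ⟨t0', t1', t2'⟩ := triEdge_vec3 u w S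
  have hpt' : ∀ k, p₂ (triEdge ![u, w, S] k) = t := by
    intro k; fin_cases k
    · exact (congrArg p₂ t0').trans (by simp [hp₁, hp₂, afterMove, triEdge, starEdge, fst3, snd3, Sym2.eq_iff, Sym2.mem_iff, unitInterval.symm_symm, p_xy, p_xA, p_yA, p_S0, p_S0', hxy, hxA, hxu, hxw, hxS, hyA, hyu, hyw, hyS, hAu, hAw, hAS, huw, huS, hwS, hxy.symm, hxA.symm, hxu.symm, hxw.symm, hxS.symm, hyA.symm, hyu.symm, hyw.symm, hyS.symm, hAu.symm, hAw.symm, hAS.symm, huw.symm, huS.symm, hwS.symm])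
    · exact (congrArg p₂ t1').trans (by simp [hp₁, hp₂, afterMove, triEdge, starEdge, fst3, snd3, Sym2.eq_iff, Sym2.mem_iff, unitInterval.symm_symm, p_xy, p_xA, p_yA, p_S0, p_S0', hxy, hxA, hxu, hxw, hxS, hyA, hyu, hyw, hyS, hAu, hAw, hAS, huw, huS, hwS, hxy.symm, hxA.symm, hxu.symm, hxw.symm, hxS.symm, hyA.symm, hyu.symm, hyw.symm, hyS.symm, hAu.symm, hAw.symm, hAS.symm, huw.symm, huS.symm, hwS.symm])
    · exact (congrArg p₂ t2').trans (by simp [hp₁, hp₂, afterMove, triEdge, starEdge, fst3, snd3, Sym2.eq_iff, Sym2.mem_iff, unitInterval.symm_symm, p_xy, p_xA, p_yA, p_S0, p_S0', hxy, hxA, hxu, hxw, hxS, hyA, hyu, hyw, hyS, hAu, hAw, hAS, huw, huS, hwS, hxy.symm, hxA.symm, hxu.symm, hxw.symm, hxS.symm, hyA.symm, hyu.symm, hyw.symm, hyS.symm, hAu.symm, hAw.symm, hAS.symm, huw.symm, huS.symm, hwS.symm])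
  have hA0 : ∀ e, A ∈ e → p₂ e = 0 := fun e he => by simp only [hp₂, if_pos he]
  have key : p₁ = afterMove p₂ ![u, w, S] A := by
    refine sym2_funext S A (fun z => ?_) (fun z hzS => ?_) (fun a b haS hbS haA hbA => ?_)
    · -- pairs containing `S`
      by_cases hzu : z = u
      · rw [hzu]; simp [hp₁, hp₂, afterMove, triEdge, starEdge, fst3, snd3, Sym2.eq_iff, Sym2.mem_iff, unitInterval.symm_symm, p_xy, p_xA, p_yA, p_S0, p_S0', hxy, hxA, hxu, hxw, hxS, hyA, hyu, hyw, hyS, hAu, hAw, hAS, huw, huS, hwS, hxy.symm, hxA.symm, hxu.symm, hxw.symm, hxS.symm, hyA.symm, hyu.symm, hyw.symm, hyS.symm, hAu.symm, hAw.symm, hAS.symm, huw.symm, huS.symm, hwS.symm]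
      by_cases hzw : z = w
      · rw [hzw]; simp [hp₁, hp₂, afterMove, triEdge, starEdge, fst3, snd3, Sym2.eq_iff, Sym2.mem_iff, unitInterval.symm_symm, p_xy, p_xA, p_yA, p_S0, p_S0', hxy, hxA, hxu, hxw, hxS, hyA, hyu, hyw, hyS, hAu, hAw, hAS, huw, huS, hwS, hxy.symm, hxA.symm, hxu.symm, hxw.symm, hxS.symm, hyA.symm, hyu.symm, hyw.symm, hyS.symm, hAu.symm, hAw.symm, hAS.symm, huw.symm, huS.symm, hwS.symm]
      by_cases hzA : z = A
      · rw [hzA]; simp [hp₁, hp₂, afterMove, triEdge, starEdge, fst3, snd3, Sym2.eq_iff, Sym2.mem_iff, unitInterval.symm_symm, p_xy, p_xA, p_yA, p_S0, p_S0', hxy, hxA, hxu, hxw, hxS, hyA, hyu, hyw, hyS, hAu, hAw, hAS, huw, huS, hwS, hxy.symm, hxA.symm, hxu.symm, hxw.symm, hxS.symm, hyA.symm, hyu.symm, hyw.symm, hyS.symm, hAu.symm, hAw.symm, hAS.symm, huw.symm, huS.symm, hwS.symm]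
      simp [hp₁, hp₂, afterMove, triEdge, starEdge, fst3, snd3, Sym2.eq_iff, Sym2.mem_iff, unitInterval.symm_symm, p_xy, p_xA, p_yA, p_S0, p_S0', hxy, hxA, hxu, hxw, hxS, hyA, hyu, hyw, hyS, hAu, hAw, hAS, huw, huS, hwS, hxy.symm, hxA.symm, hxu.symm, hxw.symm, hxS.symm, hyA.symm, hyu.symm, hyw.symm, hyS.symm, hAu.symm, hAw.symm, hAS.symm, huw.symm, huS.symm, hwS.symm, hzu, hzw, hzA, Ne.symm hzu, Ne.symm hzw, Ne.symm hzA]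
    · -- pairs containing `A` (and not `S`)
      by_cases hzu : z = u
      · rw [hzu]; simp [hp₁, hp₂, afterMove, triEdge, starEdge, fst3, snd3, Sym2.eq_iff, Sym2.mem_iff, unitInterval.symm_symm, p_xy, p_xA, p_yA, p_S0, p_S0', hxy, hxA, hxu, hxw, hxS, hyA, hyu, hyw, hyS, hAu, hAw, hAS, huw, huS, hwS, hxy.symm, hxA.symm, hxu.symm, hxw.symm, hxS.symm, hyA.symm, hyu.symm, hyw.symm, hyS.symm, hAu.symm, hAw.symm, hAS.symm, huw.symm, huS.symm, hwS.symm, p_Au]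
      by_cases hzw : z = w
      · rw [hzw]; simp [hp₁, hp₂, afterMove, triEdge, starEdge, fst3, snd3, Sym2.eq_iff, Sym2.mem_iff, unitInterval.symm_symm, p_xy, p_xA, p_yA, p_S0, p_S0', hxy, hxA, hxu, hxw, hxS, hyA, hyu, hyw, hyS, hAu, hAw, hAS, huw, huS, hwS, hxy.symm, hxA.symm, hxu.symm, hxw.symm, hxS.symm, hyA.symm, hyu.symm, hyw.symm, hyS.symm, hAu.symm, hAw.symm, hAS.symm, huw.symm, huS.symm, hwS.symm, p_Aw]
      by_cases hzx : z = x
      · rw [hzx]; simp [hp₁, hp₂, afterMove, triEdge, starEdge, fst3, snd3, Sym2.eq_iff, Sym2.mem_iff, unitInterval.symm_symm, p_xy, p_xA, p_yA, p_S0, p_S0', hxy, hxA, hxu, hxw, hxS, hyA, hyu, hyw, hyS, hAu, hAw, hAS, huw, huS, hwS, hxy.symm, hxA.symm, hxu.symm, hxw.symm, hxS.symm, hyA.symm, hyu.symm, hyw.symm, hyS.symm, hAu.symm, hAw.symm, hAS.symm, huw.symm, huS.symm, hwS.symm]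
      by_cases hzy : z = y
      · rw [hzy]; simp [hp₁, hp₂, afterMove, triEdge, starEdge, fst3, snd3, Sym2.eq_iff, Sym2.mem_iff, unitInterval.symm_symm, p_xy, p_xA, p_yA, p_S0, p_S0', hxy, hxA, hxu, hxw, hxS, hyA, hyu, hyw, hyS, hAu, hAw, hAS, huw, huS, hwS, hxy.symm, hxA.symm, hxu.symm, hxw.symm, hxS.symm, hyA.symm, hyu.symm, hyw.symm, hyS.symm, hAu.symm, hAw.symm, hAS.symm, huw.symm, huS.symm, hwS.symm]
      have := p_A0 z hzx hzy hzu hzw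
      simp [hp₁, hp₂, afterMove, triEdge, starEdge, fst3, snd3, Sym2.eq_iff, Sym2.mem_iff, unitInterval.symm_symm, p_xy, p_xA, p_yA, p_S0, p_S0', hxy, hxA, hxu, hxw, hxS, hyA, hyu, hyw, hyS, hAu, hAw, hAS, huw, huS, hwS, hxy.symm, hxA.symm, hxu.symm, hxw.symm, hxS.symm, hyA.symm, hyu.symm, hyw.symm, hyS.symm, hAu.symm, hAw.symm, hAS.symm, huw.symm, huS.symm, hwS.symm, hzu, hzw, hzx, hzy, hzS, Ne.symm hzu, Ne.symm hzw, Ne.symm hzx, Ne.symm hzy, Ne.symm hzS, this]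
    · -- pairs avoiding `S` and `A`
      by_cases h1 : s(a, b) = s(u, w)
      · rw [h1]; simp [hp₁, hp₂, afterMove, triEdge, starEdge, fst3, snd3, Sym2.eq_iff, Sym2.mem_iff, unitInterval.symm_symm, p_xy, p_xA, p_yA, p_S0, p_S0', hxy, hxA, hxu, hxw, hxS, hyA, hyu, hyw, hyS, hAu, hAw, hAS, huw, huS, hwS, hxy.symm, hxA.symm, hxu.symm, hxw.symm, hxS.symm, hyA.symm, hyu.symm, hyw.symm, hyS.symm, hAu.symm, hAw.symm, hAS.symm, huw.symm, huS.symm, hwS.symm, p_uw]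
      have h1' : ¬ ((a = u ∧ b = w) ∨ (a = w ∧ b = u)) := fun h => h1 (Sym2.eq_iff.2 h)
      simp [hp₁, hp₂, afterMove, triEdge, starEdge, fst3, snd3, Sym2.eq_iff, Sym2.mem_iff, unitInterval.symm_symm, p_xy, p_xA, p_yA, p_S0, p_S0', hxy, hxA, hxu, hxw, hxS, hyA, hyu, hyw, hyS, hAu, hAw, hAS, huw, huS, hwS, hxy.symm, hxA.symm, hxu.symm, hxw.symm, hxS.symm, hyA.symm, hyu.symm, hyw.symm, hyS.symm, hAu.symm, hAw.symm, hAS.symm, huw.symm, huS.symm, hwS.symm, haS, hbS, haA, hbA, Ne.symm haS, Ne.symm hbS, Ne.symm haA, Ne.symm hbA, h1']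
  have step2 : ConnEquiv W (∅ : Set (Sym2 V)) p₂ p₁ := by
    rw [key]
    refine connEquiv_afterMove hv' hvO' hA0 ?_ ?_ hAW (fun e he => absurd he (Set.notMem_empty e))
    · have : (fun k => ((p₂ (triEdge ![u, w, S] k) : unitInterval) : ℝ)) = fun _ => (t : ℝ) := by
        funext k; rw [hpt' k]
      rw [this, kappa_const]; linarith
    · intro k; rw [hpt' k]; exact ht1
  -- Step 3: relabel `S ↔ A`
  have step3 := connEquiv_comp_swap (W := W) p₂ hSW hAW
  have hσS : Equiv.swap S A S = A := Equiv.swap_apply_left S A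
  have hσA : Equiv.swap S A A = S := Equiv.swap_apply_right S A
  have hfin : (fun e => p₂ (Sym2.map (Equiv.swap S A) e)) = p' := by
    refine sym2_funext S A (fun z => ?_) (fun z hzS => ?_) (fun a b haS hbS haA hbA => ?_)
    · -- pairs containing `S` map to pairs containing `A`
      simp only [Sym2.map_mk, hσS]
      rw [p'_S0, hA0 _ (Sym2.mem_mk_left _ _)]
    · simp only [Sym2.map_mk, hσA]
      by_cases hzA : z = A
      · rw [hzA, hσA, p'_AA]; simp [hp₁, hp₂, afterMove, triEdge, starEdge, fst3, snd3, Sym2.eq_iff, Sym2.mem_iff, unitInterval.symm_symm, p_xy, p_xA, p_yA, p_S0, p_S0', hxy, hxA, hxu, hxw, hxS, hyA, hyu, hyw, hyS, hAu, hAw, hAS, huw, huS, hwS, hxy.symm, hxA.symm, hxu.symm, hxw.symm, hxS.symm, hyA.symm, hyu.symm, hyw.symm, hyS.symm, hAu.symm, hAw.symm, hAS.symm, huw.symm, huS.symm, hwS.symm]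
      rw [Equiv.swap_apply_of_ne_of_ne hzS hzA]
      by_cases hzu : z = u
      · rw [hzu, p'_Au]; simp [hp₁, hp₂, afterMove, triEdge, starEdge, fst3, snd3, Sym2.eq_iff, Sym2.mem_iff, unitInterval.symm_symm, p_xy, p_xA, p_yA, p_S0, p_S0', hxy, hxA, hxu, hxw, hxS, hyA, hyu, hyw, hyS, hAu, hAw, hAS, huw, huS, hwS, hxy.symm, hxA.symm, hxu.symm, hxw.symm, hxS.symm, hyA.symm, hyu.symm, hyw.symm, hyS.symm, hAu.symm, hAw.symm, hAS.symm, huw.symm, huS.symm, hwS.symm]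
      by_cases hzw : z = w
      · rw [hzw, p'_Aw]; simp [hp₁, hp₂, afterMove, triEdge, starEdge, fst3, snd3, Sym2.eq_iff, Sym2.mem_iff, unitInterval.symm_symm, p_xy, p_xA, p_yA, p_S0, p_S0', hxy, hxA, hxu, hxw, hxS, hyA, hyu, hyw, hyS, hAu, hAw, hAS, huw, huS, hwS, hxy.symm, hxA.symm, hxu.symm, hxw.symm, hxS.symm, hyA.symm, hyu.symm, hyw.symm, hyS.symm, hAu.symm, hAw.symm, hAS.symm, huw.symm, huS.symm, hwS.symm]
      by_cases hzx : z = x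
      · rw [hzx, Sym2.eq_swap (a := A), p'_xA]; simp [hp₁, hp₂, afterMove, triEdge, starEdge, fst3, snd3, Sym2.eq_iff, Sym2.mem_iff, unitInterval.symm_symm, p_xy, p_xA, p_yA, p_S0, p_S0', hxy, hxA, hxu, hxw, hxS, hyA, hyu, hyw, hyS, hAu, hAw, hAS, huw, huS, hwS, hxy.symm, hxA.symm, hxu.symm, hxw.symm, hxS.symm, hyA.symm, hyu.symm, hyw.symm, hyS.symm, hAu.symm, hAw.symm, hAS.symm, huw.symm, huS.symm, hwS.symm]
      by_cases hzy : z = y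
      · rw [hzy, Sym2.eq_swap (a := A), p'_yA]; simp [hp₁, hp₂, afterMove, triEdge, starEdge, fst3, snd3, Sym2.eq_iff, Sym2.mem_iff, unitInterval.symm_symm, p_xy, p_xA, p_yA, p_S0, p_S0', hxy, hxA, hxu, hxw, hxS, hyA, hyu, hyw, hyS, hAu, hAw, hAS, huw, huS, hwS, hxy.symm, hxA.symm, hxu.symm, hxw.symm, hxS.symm, hyA.symm, hyu.symm, hyw.symm, hyS.symm, hAu.symm, hAw.symm, hAS.symm, huw.symm, huS.symm, hwS.symm]
      rw [p'_A0 z hzx hzy hzu hzw]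
      simp [hp₁, hp₂, afterMove, triEdge, starEdge, fst3, snd3, Sym2.eq_iff, Sym2.mem_iff, unitInterval.symm_symm, p_xy, p_xA, p_yA, p_S0, p_S0', hxy, hxA, hxu, hxw, hxS, hyA, hyu, hyw, hyS, hAu, hAw, hAS, huw, huS, hwS, hxy.symm, hxA.symm, hxu.symm, hxw.symm, hxS.symm, hyA.symm, hyu.symm, hyw.symm, hyS.symm, hAu.symm, hAw.symm, hAS.symm, huw.symm, huS.symm, hwS.symm, hzu, hzw, hzx, hzy, hzS, hzA, Ne.symm hzu, Ne.symm hzw, Ne.symm hzx, Ne.symm hzy, Ne.symm hzS, Ne.symm hzA]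
    · simp only [Sym2.map_mk, Equiv.swap_apply_of_ne_of_ne haS haA,
        Equiv.swap_apply_of_ne_of_ne hbS hbA]
      by_cases h1 : s(a, b) = s(u, w)
      · rw [h1, p'_uw]; simp [hp₁, hp₂, afterMove, triEdge, starEdge, fst3, snd3, Sym2.eq_iff, Sym2.mem_iff, unitInterval.symm_symm, p_xy, p_xA, p_yA, p_S0, p_S0', hxy, hxA, hxu, hxw, hxS, hyA, hyu, hyw, hyS, hAu, hAw, hAS, huw, huS, hwS, hxy.symm, hxA.symm, hxu.symm, hxw.symm, hxS.symm, hyA.symm, hyu.symm, hyw.symm, hyS.symm, hAu.symm, hAw.symm, hAS.symm, huw.symm, huS.symm, hwS.symm]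
      by_cases h2 : s(a, b) = s(x, y)
      · rw [h2, p'_xy]; simp [hp₁, hp₂, afterMove, triEdge, starEdge, fst3, snd3, Sym2.eq_iff, Sym2.mem_iff, unitInterval.symm_symm, p_xy, p_xA, p_yA, p_S0, p_S0', hxy, hxA, hxu, hxw, hxS, hyA, hyu, hyw, hyS, hAu, hAw, hAS, huw, huS, hwS, hxy.symm, hxA.symm, hxu.symm, hxw.symm, hxS.symm, hyA.symm, hyu.symm, hyw.symm, hyS.symm, hAu.symm, hAw.symm, hAS.symm, huw.symm, huS.symm, hwS.symm]
      rw [p'_rest a b h2 h1 haA hbA haS hbS]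
      have h1' : ¬ ((a = u ∧ b = w) ∨ (a = w ∧ b = u)) := fun h => h1 (Sym2.eq_iff.2 h)
      have h2' : ¬ ((a = x ∧ b = y) ∨ (a = y ∧ b = x)) := fun h => h2 (Sym2.eq_iff.2 h)
      simp [hp₁, hp₂, afterMove, triEdge, starEdge, fst3, snd3, Sym2.eq_iff, Sym2.mem_iff, unitInterval.symm_symm, p_xy, p_xA, p_yA, p_S0, p_S0', hxy, hxA, hxu, hxw, hxS, hyA, hyu, hyw, hyS, hAu, hAw, hAS, huw, huS, hwS, hxy.symm, hxA.symm, hxu.symm, hxw.symm, hxS.symm, hyA.symm, hyu.symm, hyw.symm, hyS.symm, hAu.symm, hAw.symm, hAS.symm, huw.symm, huS.symm, hwS.symm, haS, hbS, haA, hbA, Ne.symm haS, Ne.symm hbS, Ne.symm haA, Ne.symm hbA, h1', h2']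
  rw [← hfin]
  exact step1.trans (step2.symm.trans step3)

set_option linter.unusedSimpArgs false in
set_option maxHeartbeats 800000 in
/-- **The half step** at the top row (the apex `A` has no upper edges): triangle → star at
`{x, y, A}` with the spare label `S` as centre, removal of the now pendant edge at `A`, and the
relabelling `S ↔ A`. Net effect on the weights: `{x,y} : t ↦ 0`, `{x,A}, {y,A} : t ↦ 1 − t`, all
other pairs unchanged (`S` isolated before and after). -/
theorem connEquiv_halfStep {p p' : Sym2 V → unitInterval} {x y A S : V}
    (hxy : x ≠ y) (hxA : x ≠ A) (hxS : x ≠ S) (hyA : y ≠ A) (hyS : y ≠ S) (hAS : A ≠ S)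
    (hAW : A ∉ W) (hSW : S ∉ W) {t : unitInterval}
    (ht3 : 3 * (t : ℝ) - (t : ℝ) ^ 3 = 1) (ht1 : (t : ℝ) < 1)
    (p_xy : p s(x, y) = t) (p_xA : p s(x, A) = t) (p_yA : p s(y, A) = t)
    (p_A0 : ∀ z, z ≠ x → z ≠ y → p s(A, z) = 0)
    (p_S0 : ∀ z, p s(S, z) = 0)
    (p'_xy : p' s(x, y) = 0) (p'_xA : p' s(x, A) = unitInterval.symm t)
    (p'_yA : p' s(y, A) = unitInterval.symm t)
    (p'_A0 : ∀ z, z ≠ x → z ≠ y → p' s(A, z) = 0)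
    (p'_S0 : ∀ z, p' s(S, z) = 0)
    (p'_rest : ∀ a b, s(a, b) ≠ s(x, y) → a ≠ A → b ≠ A → a ≠ S → b ≠ S →
      p' s(a, b) = p s(a, b)) :
    ConnEquiv W (∅ : Set (Sym2 V)) p p' := by
  have p_S0' : ∀ z, p s(z, S) = 0 := fun z => by rw [Sym2.eq_swap]; exact p_S0 z
  have p_AA : p s(A, A) = 0 := p_A0 A hxA.symm hyA.symm
  have p'_AA : p' s(A, A) = 0 := p'_A0 A hxA.symm hyA.symm
  -- Step 1: triangle → star at `{x, y, A}` with centre `S`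
  set p₁ : Sym2 V → unitInterval := afterMove p ![x, y, A] S with hp₁
  have hv := injective_vec3 hxy hxA hyA
  have hvO : ∀ k, (![x, y, A] : Fin 3 → V) k ≠ S := by
    intro k; fin_cases k <;> simpa
  obtain ⟨t0, t1, t2⟩ := triEdge_vec3 x y A
  have hpt : ∀ k, p (triEdge ![x, y, A] k) = t := by
    intro k; fin_cases k
    · exact t0 ▸ p_yA
    · exact t1 ▸ p_xA
    · exact t2 ▸ p_xy
  have hS0 : ∀ e, S ∈ e → p e = 0 := by
    intro e he
    induction e using Sym2.ind with
    | h a b =>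
      rcases Sym2.mem_iff.1 he with rfl | rfl
      · exact p_S0 b
      · exact p_S0' a
  have step1 : ConnEquiv W (∅ : Set (Sym2 V)) p p₁ := by
    refine connEquiv_afterMove hv hvO hS0 ?_ ?_ hSW (fun e he => absurd he (Set.notMem_empty e))
    · have : (fun k => ((p (triEdge ![x, y, A] k) : unitInterval) : ℝ)) = fun _ => (t : ℝ) := by
        funext k; rw [hpt k]
      rw [this, kappa_const]; linarith
    · intro k; rw [hpt k]; exact ht1
  -- Step 2: the edge `{A, S}` is now pendant at `A`; switch it off
  set p₂ : Sym2 V → unitInterval := Function.update p₁ s(A, S) 0 with hp₂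
  have hpend : ∀ e, A ∈ e → e ≠ s(A, S) → p₁ e = 0 := by
    intro e he hne
    induction e using Sym2.ind with
    | h a b =>
      have key : ∀ z, z ≠ S → p₁ s(A, z) = 0 := by
        intro z hzS
        by_cases hzx : z = x
        · rw [hzx]; simp [hp₁, hp₂, afterMove, triEdge, starEdge, fst3, snd3, Sym2.eq_iff, Sym2.mem_iff, unitInterval.symm_symm, p_xy, p_xA, p_yA, p_S0, p_S0', Function.update_apply, hxy, hxA, hxS, hyA, hyS, hAS, hxy.symm, hxA.symm, hxS.symm, hyA.symm, hyS.symm, hAS.symm]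
        by_cases hzy : z = y
        · rw [hzy]; simp [hp₁, hp₂, afterMove, triEdge, starEdge, fst3, snd3, Sym2.eq_iff, Sym2.mem_iff, unitInterval.symm_symm, p_xy, p_xA, p_yA, p_S0, p_S0', Function.update_apply, hxy, hxA, hxS, hyA, hyS, hAS, hxy.symm, hxA.symm, hxS.symm, hyA.symm, hyS.symm, hAS.symm]
        have := p_A0 z hzx hzy
        simp [hp₁, hp₂, afterMove, triEdge, starEdge, fst3, snd3, Sym2.eq_iff, Sym2.mem_iff, unitInterval.symm_symm, p_xy, p_xA, p_yA, p_S0, p_S0', Function.update_apply, hxy, hxA, hxS, hyA, hyS, hAS, hxy.symm, hxA.symm, hxS.symm, hyA.symm, hyS.symm, hAS.symm, hzx, hzy, hzS, Ne.symm hzx, Ne.symm hzy, Ne.symm hzS, this]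
      rcases Sym2.mem_iff.1 he with rfl | rfl
      · exact key b (fun h => hne (by rw [h]))
      · rw [Sym2.eq_swap]
        exact key a (fun h => hne (by rw [h, Sym2.eq_swap]))
  have step2 : ConnEquiv W (∅ : Set (Sym2 V)) p₁ p₂ :=
    connEquiv_update_zero_of_pendant p₁ hAW (Set.notMem_empty _) hpend
  -- Step 3: relabel `S ↔ A`
  have step3 := connEquiv_comp_swap (W := W) p₂ hSW hAW
  have hσS : Equiv.swap S A S = A := Equiv.swap_apply_left S A
  have hσA : Equiv.swap S A A = S := Equiv.swap_apply_right S A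
  have hfin : (fun e => p₂ (Sym2.map (Equiv.swap S A) e)) = p' := by
    refine sym2_funext S A (fun z => ?_) (fun z hzS => ?_) (fun a b haS hbS haA hbA => ?_)
    · simp only [Sym2.map_mk, hσS]
      rw [p'_S0]
      by_cases hz : Equiv.swap S A z = S
      · rw [hz, hp₂, Function.update_self]
      · rw [hp₂, Function.update_of_ne (fun h => hz ((Sym2.congr_right).1 h))]
        exact hpend _ (Sym2.mem_mk_left _ _) (fun h => hz ((Sym2.congr_right).1 h))
    · simp only [Sym2.map_mk, hσA]
      by_cases hzA : z = A
      · rw [hzA, hσA, p'_AA]; simp [hp₁, hp₂, afterMove, triEdge, starEdge, fst3, snd3, Sym2.eq_iff, Sym2.mem_iff, unitInterval.symm_symm, p_xy, p_xA, p_yA, p_S0, p_S0', Function.update_apply, hxy, hxA, hxS, hyA, hyS, hAS, hxy.symm, hxA.symm, hxS.symm, hyA.symm, hyS.symm, hAS.symm]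
      rw [Equiv.swap_apply_of_ne_of_ne hzS hzA]
      by_cases hzx : z = x
      · rw [hzx, Sym2.eq_swap (a := A), p'_xA]; simp [hp₁, hp₂, afterMove, triEdge, starEdge, fst3, snd3, Sym2.eq_iff, Sym2.mem_iff, unitInterval.symm_symm, p_xy, p_xA, p_yA, p_S0, p_S0', Function.update_apply, hxy, hxA, hxS, hyA, hyS, hAS, hxy.symm, hxA.symm, hxS.symm, hyA.symm, hyS.symm, hAS.symm]
      by_cases hzy : z = y
      · rw [hzy, Sym2.eq_swap (a := A), p'_yA]; simp [hp₁, hp₂, afterMove, triEdge, starEdge, fst3, snd3, Sym2.eq_iff, Sym2.mem_iff, unitInterval.symm_symm, p_xy, p_xA, p_yA, p_S0, p_S0', Function.update_apply, hxy, hxA, hxS, hyA, hyS, hAS, hxy.symm, hxA.symm, hxS.symm, hyA.symm, hyS.symm, hAS.symm]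
      rw [p'_A0 z hzx hzy]
      simp [hp₁, hp₂, afterMove, triEdge, starEdge, fst3, snd3, Sym2.eq_iff, Sym2.mem_iff, unitInterval.symm_symm, p_xy, p_xA, p_yA, p_S0, p_S0', Function.update_apply, hxy, hxA, hxS, hyA, hyS, hAS, hxy.symm, hxA.symm, hxS.symm, hyA.symm, hyS.symm, hAS.symm, hzx, hzy, hzS, hzA, Ne.symm hzx, Ne.symm hzy, Ne.symm hzS, Ne.symm hzA]
    · simp only [Sym2.map_mk, Equiv.swap_apply_of_ne_of_ne haS haA,
        Equiv.swap_apply_of_ne_of_ne hbS hbA]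
      by_cases h2 : s(a, b) = s(x, y)
      · rw [h2, p'_xy]; simp [hp₁, hp₂, afterMove, triEdge, starEdge, fst3, snd3, Sym2.eq_iff, Sym2.mem_iff, unitInterval.symm_symm, p_xy, p_xA, p_yA, p_S0, p_S0', Function.update_apply, hxy, hxA, hxS, hyA, hyS, hAS, hxy.symm, hxA.symm, hxS.symm, hyA.symm, hyS.symm, hAS.symm]
      rw [p'_rest a b h2 haA hbA haS hbS]
      have h2' : ¬ ((a = x ∧ b = y) ∨ (a = y ∧ b = x)) := fun h => h2 (Sym2.eq_iff.2 h)
      simp [hp₁, hp₂, afterMove, triEdge, starEdge, fst3, snd3, Sym2.eq_iff, Sym2.mem_iff, unitInterval.symm_symm, p_xy, p_xA, p_yA, p_S0, p_S0', Function.update_apply, hxy, hxA, hxS, hyA, hyS, hAS, hxy.symm, hxA.symm, hxS.symm, hyA.symm, hyS.symm, hAS.symm, haS, hbS, haA, hbA, Ne.symm haS, Ne.symm hbS, Ne.symm haA, Ne.symm hbA, h2']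
  rw [← hfin]
  exact step1.trans (step2.trans step3)

end Moves

end Summit.CriticalPhenomena.CardyFormulaZ2.Theorems.TriSweep

end
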